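import Summits.Ventures.PercRepro.Night2FatBudgetFSK
import Summits.Ventures.PercRepro.Night2SeriesClassesThreeOne
import Summits.Ventures.PercRepro.Night2SeriesClassesCells

/-!
# PercRepro — the face-sum budget with coloops at `(3, 1)`: the survivors `[2, 2]` at `|G| = 11`, `[3]` at `|G| = 15`,
`[2]` at `|G| = 16, 17`: the generic cells (night-2, gen 23)

With the chord through `(3, 1/6)` and the face-sum constraint (`fatBudgetFSK`, `capDG 5 3 1 = 17/24`) the excess at
`(3, 1)` improves enough for: two disjoint fat pairs with `≤ 2` closures at `n = 10` (`E = 967/3240`, count sum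
`1.0195`), a triangle with `≤ 3` closures at `n = 14` (`337/1560`, `1.0259`), a single fat pair at `n = 15`
(`3/20`, `1.0032`) and `n = 16` (`29/216`, `1.356`).  The explicit cells are in
`Night2SeriesClassesThreeOneFSCells`, the residues S in `Night2SeriesClassesThreeOneFSResidues`.
-/

namespace PercRepro.Shadow

open Finset PerFlat ThmH

/-- The chord of `1/(m + 3)` on `3 ≤ m ≤ 10` (`n = 14` at `(3, 1)`): `1/(m+3) ≤ 8/39 − m/78`. -/
theorem chord3_three_one_14 : ∀ m : ℕ, 3 ≤ m → m ≤ 10 →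
    1 / ((m : ℚ) + ((3 : ℕ) : ℚ)) ≤ (8 / 39 : ℚ) - (1 / 78 : ℚ) * (m : ℚ) := by
  intro m h1 h2
  interval_cases m <;> norm_num

/-- The chord of `1/(m + 3)` on `3 ≤ m ≤ 11` (`n = 15` at `(3, 1)`): `1/(m+3) ≤ 17/84 − m/84`. -/
theorem chord3_three_one_15 : ∀ m : ℕ, 3 ≤ m → m ≤ 11 →
    1 / ((m : ℚ) + ((3 : ℕ) : ℚ)) ≤ (17 / 84 : ℚ) - (1 / 84 : ℚ) * (m : ℚ) := by
  intro m h1 h2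
  interval_cases m <;> norm_num

/-- The chord of `1/(m + 3)` on `3 ≤ m ≤ 12` (`n = 16` at `(3, 1)`): `1/(m+3) ≤ 1/5 − m/90`. -/
theorem chord3_three_one_16 : ∀ m : ℕ, 3 ≤ m → m ≤ 12 →
    1 / ((m : ℚ) + ((3 : ℕ) : ℚ)) ≤ (1 / 5 : ℚ) - (1 / 90 : ℚ) * (m : ℚ) := by
  intro m h1 h2
  interval_cases m <;> norm_num

/-- `fatBudgetFSK 5 3 5 2 10 (2/9) (1/54) 1 = 967/3240`. -/
theorem fatBudgetFSK_three_one_ten_two :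
    fatBudgetFSK 5 3 5 2 10 (2 / 9 : ℚ) (1 / 54 : ℚ) 1 = (967 / 3240 : ℚ) := by
  unfold fatBudgetFSK capDG phiQ; norm_num

/-- `fatBudgetFSK 5 3 5 3 14 (8/39) (1/78) 1 = 337/1560`. -/
theorem fatBudgetFSK_three_one_fourteen_three :
    fatBudgetFSK 5 3 5 3 14 (8 / 39 : ℚ) (1 / 78 : ℚ) 1 = (337 / 1560 : ℚ) := by
  unfold fatBudgetFSK capDG phiQ; norm_num

/-- `fatBudgetFSK 5 3 5 1 15 (17/84) (1/84) 1 = 3/20`. -/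
theorem fatBudgetFSK_three_one_fifteen_one :
    fatBudgetFSK 5 3 5 1 15 (17 / 84 : ℚ) (1 / 84 : ℚ) 1 = (3 / 20 : ℚ) := by
  unfold fatBudgetFSK capDG phiQ; norm_num

/-- `fatBudgetFSK 5 3 5 1 16 (1/5) (1/90) 1 = 29/216`. -/
theorem fatBudgetFSK_three_one_sixteen_one :
    fatBudgetFSK 5 3 5 1 16 (1 / 5 : ℚ) (1 / 90 : ℚ) 1 = (29 / 216 : ℚ) := by
  unfold fatBudgetFSK capDG phiQ; norm_num

/-- `cntSeries 5 s [2] > 0` for `6 ≤ s ≤ 16`. -/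
theorem cntSeries_five_2_pos : ∀ s, 6 ≤ s → s ≤ 16 → 0 < (cntSeries 5 s [2] : ℚ) := by
  intro s h1 h2
  interval_cases s <;> norm_num [cntSeries, Nat.choose_eq_descFactorial_div_factorial, Nat.descFactorial, Nat.factorial]

/-- The count sum of the cell `(3, 1)` at `n = 10` with the series classes `[2, 2]` and the face-sum budget
`E = 967 / 3240`: `1.0195 ≥ 1`. -/
theorem countSum_three_one_ten_22FS :
    1 ≤ countSum 10 5 3 (cPrimeDGP 5 3 5 1 2) (967 / 3240 : ℚ) (fun s => (cntSeries 5 s [2, 2] : ℚ)) := by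
  rw [cPrimeDGP_three_one_two]
  unfold countSum DGenP.cjG
  rw [show Finset.Icc 1 (10 - 5) = {1, 2, 3, 4, 5} by decide]
  repeat rw [Finset.sum_insert (by decide)]
  rw [Finset.sum_singleton]
  norm_num [cntSeries, Nat.choose_eq_descFactorial_div_factorial, Nat.descFactorial, Nat.factorial]

/-- The count sum of the cell `(3, 1)` at `n = 14` with the series classes `[3]` and the face-sum budget
`E = 337 / 1560`: `1.0259 ≥ 1`. -/
theorem countSum_three_one_fourteen_3FS :
    1 ≤ countSum 14 5 3 (cPrimeDGP 5 3 5 1 2) (337 / 1560 : ℚ) (fun s => (cntSeries 5 s [3] : ℚ)) := by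
  rw [cPrimeDGP_three_one_two]
  unfold countSum DGenP.cjG
  rw [show Finset.Icc 1 (14 - 5) = {1, 2, 3, 4, 5, 6, 7, 8, 9} by decide]
  repeat rw [Finset.sum_insert (by decide)]
  rw [Finset.sum_singleton]
  norm_num [cntSeries, Nat.choose_eq_descFactorial_div_factorial, Nat.descFactorial, Nat.factorial]

/-- The count sum of the cell `(3, 1)` at `n = 15` with the series classes `[2]` and the face-sum budget
`E = 3 / 20`: `1.0032 ≥ 1`. -/
theorem countSum_three_one_fifteen_2FS :
    1 ≤ countSum 15 5 3 (cPrimeDGP 5 3 5 1 2) (3 / 20 : ℚ) (fun s => (cntSeries 5 s [2] : ℚ)) := by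
  rw [cPrimeDGP_three_one_two]
  unfold countSum DGenP.cjG
  rw [show Finset.Icc 1 (15 - 5) = {1, 2, 3, 4, 5, 6, 7, 8, 9, 10} by decide]
  repeat rw [Finset.sum_insert (by decide)]
  rw [Finset.sum_singleton]
  norm_num [cntSeries, Nat.choose_eq_descFactorial_div_factorial, Nat.descFactorial, Nat.factorial]

/-- The count sum of the cell `(3, 1)` at `n = 16` with the series classes `[2]` and the face-sum budget
`E = 29 / 216`: `1.3558 ≥ 1`. -/
theorem countSum_three_one_sixteen_2FS :
    1 ≤ countSum 16 5 3 (cPrimeDGP 5 3 5 1 2) (29 / 216 : ℚ) (fun s => (cntSeries 5 s [2] : ℚ)) := by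
  rw [cPrimeDGP_three_one_two]
  unfold countSum DGenP.cjG
  rw [show Finset.Icc 1 (16 - 5) = {1, 2, 3, 4, 5, 6, 7, 8, 9, 10, 11} by decide]
  repeat rw [Finset.sum_insert (by decide)]
  rw [Finset.sum_singleton]
  norm_num [cntSeries, Nat.choose_eq_descFactorial_div_factorial, Nat.descFactorial, Nat.factorial]

variable {α : Type*} [DecidableEq α] {M : Matroid α} [M.Finite]

open scoped Classical in
/-- **The generic series-class cell `(3, 1)` at `|G| = 11` with the face-sum budget at `≤ 2` fat thin closures**
(`E = 967 / 3240`). -/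
theorem localShadowHall_three_one_five_eleven_of_classesFS {G : Finset α} (hG : G ∈ flatsQ M (5 + 1))
    (hd : (gr M \ G).card = 3) (hk : kColoops M G = 1)
    (hs : ∀ e ∈ gr M, ∀ f ∈ gr M, e ≠ f → rkN M {e, f} = 2) (hl : ∀ e ∈ gr M, M.Indep {e})
    (hn : G.card = 11) (hcl : (fatClosures M 5 G 2).card ≤ 2) (Cs : List (Finset α)) (hpw : Cs.Pairwise Disjoint)
    (hsz : ∀ C ∈ Cs, 1 ≤ C.card)
    (hcoc : ∀ C ∈ Cs, ∀ a ∈ C, ∀ b ∈ C, a ≠ b →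
      coloops M G ⊆ G \ {a, b} ∧ M.eRk ((G \ {a, b} : Finset α) : Set α) ≤ ((5 : ℕ) : ℕ∞))
    (hpos : ∀ s, 6 ≤ s → s ≤ 10 → 0 < (cntSeries 5 s (Cs.map Finset.card) : ℚ))
    (hsum : 1 ≤ countSum 10 5 3 (cPrimeDGP 5 3 5 1 2) (967 / 3240 : ℚ) (fun s => (cntSeries 5 s (Cs.map Finset.card) : ℚ))) :
    LocalShadowHall M 5 G := by
  have hk' : kColoops M G + 5 = 5 + 1 := by omega
  have hd' : (gr M \ G).card ≤ 5 := by omega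
  have hm2 : ∀ B ∈ thinMembers M 5 G, 5 ≤ (B \ coloops M G).card → 2 ≤ (G \ clF M B).card :=
    fun B hB _ => two_le_card_sdiff_of_not_lay0 hG hd' (mem_thinMembers.1 hB).1 (mem_thinMembers.1 hB).2
  have hc2 : 0 ≤ cPrimeDGP 5 3 5 (kColoops M G) 2 := by
    rw [hk]; unfold cPrimeDGP capDG reqDGP phiQ; norm_num
  have hn' : G.card - kColoops M G = 10 := by omega
  have hKG : coloops M G ⊆ G := fun y hy => (mem_coloops.1 hy).1
  have hnK : (G \ coloops M G).card = 10 := by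
    rw [Finset.card_sdiff_of_subset hKG, ← kColoops_eq_card_coloops]; omega
  refine localShadowHall_excess_of_count (d := 3) (ρ := 5) (m₁ := 2) hG hd (by norm_num) hk' (by norm_num)
    hs hl hc2 hm2 (E := (967 / 3240 : ℚ)) (by norm_num) ?_ (cnt := fun s => (cntSeries 5 s (Cs.map Finset.card) : ℚ)) ?_ ?_ ?_
  · intro S _ T hT
    have hT' : T ∈ (S \ coloops M G).powersetCard 5 := by
      unfold coverBases at hT
      exact (Finset.mem_filter.1 hT).1
    have h := sum_faceLoss_budgetFSK_union_le (k := 2) (a := (2 / 9 : ℚ)) (b := (1 / 54 : ℚ)) hG hd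
      (by norm_num) hk' (by norm_num) hs hl (by norm_num) (by rw [hnK]; norm_num)
      (by rw [hnK]; intro m h1 h2; exact chord3_three_zero_11 m h1 (by omega)) (by norm_num)
      (by rw [hnK, hk, fatBudgetFSK_three_one_ten_two]; norm_num) hcl hT'
    rw [hnK, hk, fatBudgetFSK_three_one_ten_two] at h
    exact h
  · intro s h1 h2
    rw [hn'] at h2
    exact hpos s h1 h2
  · intro S hSG
    exact card_coverBases_le_cntSeries hk' Cs hpw hsz hcoc hSG
  · rw [hn', hk]
    exact hsum

open scoped Classical in
/-- **The generic series-class cell `(3, 1)` at `|G| = 15` with the face-sum budget at `≤ 3` fat thin closures**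
(`E = 337 / 1560`). -/
theorem localShadowHall_three_one_five_fifteen_of_classesFS {G : Finset α} (hG : G ∈ flatsQ M (5 + 1))
    (hd : (gr M \ G).card = 3) (hk : kColoops M G = 1)
    (hs : ∀ e ∈ gr M, ∀ f ∈ gr M, e ≠ f → rkN M {e, f} = 2) (hl : ∀ e ∈ gr M, M.Indep {e})
    (hn : G.card = 15) (hcl : (fatClosures M 5 G 2).card ≤ 3) (Cs : List (Finset α)) (hpw : Cs.Pairwise Disjoint)
    (hsz : ∀ C ∈ Cs, 1 ≤ C.card)
    (hcoc : ∀ C ∈ Cs, ∀ a ∈ C, ∀ b ∈ C, a ≠ b →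
      coloops M G ⊆ G \ {a, b} ∧ M.eRk ((G \ {a, b} : Finset α) : Set α) ≤ ((5 : ℕ) : ℕ∞))
    (hpos : ∀ s, 6 ≤ s → s ≤ 14 → 0 < (cntSeries 5 s (Cs.map Finset.card) : ℚ))
    (hsum : 1 ≤ countSum 14 5 3 (cPrimeDGP 5 3 5 1 2) (337 / 1560 : ℚ) (fun s => (cntSeries 5 s (Cs.map Finset.card) : ℚ))) :
    LocalShadowHall M 5 G := by
  have hk' : kColoops M G + 5 = 5 + 1 := by omega
  have hd' : (gr M \ G).card ≤ 5 := by omega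
  have hm2 : ∀ B ∈ thinMembers M 5 G, 5 ≤ (B \ coloops M G).card → 2 ≤ (G \ clF M B).card :=
    fun B hB _ => two_le_card_sdiff_of_not_lay0 hG hd' (mem_thinMembers.1 hB).1 (mem_thinMembers.1 hB).2
  have hc2 : 0 ≤ cPrimeDGP 5 3 5 (kColoops M G) 2 := by
    rw [hk]; unfold cPrimeDGP capDG reqDGP phiQ; norm_num
  have hn' : G.card - kColoops M G = 14 := by omega
  have hKG : coloops M G ⊆ G := fun y hy => (mem_coloops.1 hy).1
  have hnK : (G \ coloops M G).card = 14 := by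
    rw [Finset.card_sdiff_of_subset hKG, ← kColoops_eq_card_coloops]; omega
  refine localShadowHall_excess_of_count (d := 3) (ρ := 5) (m₁ := 2) hG hd (by norm_num) hk' (by norm_num)
    hs hl hc2 hm2 (E := (337 / 1560 : ℚ)) (by norm_num) ?_ (cnt := fun s => (cntSeries 5 s (Cs.map Finset.card) : ℚ)) ?_ ?_ ?_
  · intro S _ T hT
    have hT' : T ∈ (S \ coloops M G).powersetCard 5 := by
      unfold coverBases at hT
      exact (Finset.mem_filter.1 hT).1
    have h := sum_faceLoss_budgetFSK_union_le (k := 3) (a := (8 / 39 : ℚ)) (b := (1 / 78 : ℚ)) hG hd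
      (by norm_num) hk' (by norm_num) hs hl (by norm_num) (by rw [hnK]; norm_num)
      (by rw [hnK]; intro m h1 h2; exact chord3_three_one_14 m h1 (by omega)) (by norm_num)
      (by rw [hnK, hk, fatBudgetFSK_three_one_fourteen_three]; norm_num) hcl hT'
    rw [hnK, hk, fatBudgetFSK_three_one_fourteen_three] at h
    exact h
  · intro s h1 h2
    rw [hn'] at h2
    exact hpos s h1 h2
  · intro S hSG
    exact card_coverBases_le_cntSeries hk' Cs hpw hsz hcoc hSG
  · rw [hn', hk]
    exact hsum

open scoped Classical in
/-- **The generic series-class cell `(3, 1)` at `|G| = 16` with the face-sum budget at `≤ 1` fat thin closures**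
(`E = 3 / 20`). -/
theorem localShadowHall_three_one_five_sixteen_of_classesFS {G : Finset α} (hG : G ∈ flatsQ M (5 + 1))
    (hd : (gr M \ G).card = 3) (hk : kColoops M G = 1)
    (hs : ∀ e ∈ gr M, ∀ f ∈ gr M, e ≠ f → rkN M {e, f} = 2) (hl : ∀ e ∈ gr M, M.Indep {e})
    (hn : G.card = 16) (hcl : (fatClosures M 5 G 2).card ≤ 1) (Cs : List (Finset α)) (hpw : Cs.Pairwise Disjoint)
    (hsz : ∀ C ∈ Cs, 1 ≤ C.card)
    (hcoc : ∀ C ∈ Cs, ∀ a ∈ C, ∀ b ∈ C, a ≠ b →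
      coloops M G ⊆ G \ {a, b} ∧ M.eRk ((G \ {a, b} : Finset α) : Set α) ≤ ((5 : ℕ) : ℕ∞))
    (hpos : ∀ s, 6 ≤ s → s ≤ 15 → 0 < (cntSeries 5 s (Cs.map Finset.card) : ℚ))
    (hsum : 1 ≤ countSum 15 5 3 (cPrimeDGP 5 3 5 1 2) (3 / 20 : ℚ) (fun s => (cntSeries 5 s (Cs.map Finset.card) : ℚ))) :
    LocalShadowHall M 5 G := by
  have hk' : kColoops M G + 5 = 5 + 1 := by omega
  have hd' : (gr M \ G).card ≤ 5 := by omega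
  have hm2 : ∀ B ∈ thinMembers M 5 G, 5 ≤ (B \ coloops M G).card → 2 ≤ (G \ clF M B).card :=
    fun B hB _ => two_le_card_sdiff_of_not_lay0 hG hd' (mem_thinMembers.1 hB).1 (mem_thinMembers.1 hB).2
  have hc2 : 0 ≤ cPrimeDGP 5 3 5 (kColoops M G) 2 := by
    rw [hk]; unfold cPrimeDGP capDG reqDGP phiQ; norm_num
  have hn' : G.card - kColoops M G = 15 := by omega
  have hKG : coloops M G ⊆ G := fun y hy => (mem_coloops.1 hy).1
  have hnK : (G \ coloops M G).card = 15 := by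
    rw [Finset.card_sdiff_of_subset hKG, ← kColoops_eq_card_coloops]; omega
  refine localShadowHall_excess_of_count (d := 3) (ρ := 5) (m₁ := 2) hG hd (by norm_num) hk' (by norm_num)
    hs hl hc2 hm2 (E := (3 / 20 : ℚ)) (by norm_num) ?_ (cnt := fun s => (cntSeries 5 s (Cs.map Finset.card) : ℚ)) ?_ ?_ ?_
  · intro S _ T hT
    have hT' : T ∈ (S \ coloops M G).powersetCard 5 := by
      unfold coverBases at hT
      exact (Finset.mem_filter.1 hT).1
    have h := sum_faceLoss_budgetFSK_union_le (k := 1) (a := (17 / 84 : ℚ)) (b := (1 / 84 : ℚ)) hG hd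
      (by norm_num) hk' (by norm_num) hs hl (by norm_num) (by rw [hnK]; norm_num)
      (by rw [hnK]; intro m h1 h2; exact chord3_three_one_15 m h1 (by omega)) (by norm_num)
      (by rw [hnK, hk, fatBudgetFSK_three_one_fifteen_one]; norm_num) hcl hT'
    rw [hnK, hk, fatBudgetFSK_three_one_fifteen_one] at h
    exact h
  · intro s h1 h2
    rw [hn'] at h2
    exact hpos s h1 h2
  · intro S hSG
    exact card_coverBases_le_cntSeries hk' Cs hpw hsz hcoc hSG
  · rw [hn', hk]
    exact hsum

open scoped Classical in
/-- **The generic series-class cell `(3, 1)` at `|G| = 17` with the face-sum budget at `≤ 1` fat thin closures**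
(`E = 29 / 216`). -/
theorem localShadowHall_three_one_five_seventeen_of_classesFS {G : Finset α} (hG : G ∈ flatsQ M (5 + 1))
    (hd : (gr M \ G).card = 3) (hk : kColoops M G = 1)
    (hs : ∀ e ∈ gr M, ∀ f ∈ gr M, e ≠ f → rkN M {e, f} = 2) (hl : ∀ e ∈ gr M, M.Indep {e})
    (hn : G.card = 17) (hcl : (fatClosures M 5 G 2).card ≤ 1) (Cs : List (Finset α)) (hpw : Cs.Pairwise Disjoint)
    (hsz : ∀ C ∈ Cs, 1 ≤ C.card)
    (hcoc : ∀ C ∈ Cs, ∀ a ∈ C, ∀ b ∈ C, a ≠ b →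
      coloops M G ⊆ G \ {a, b} ∧ M.eRk ((G \ {a, b} : Finset α) : Set α) ≤ ((5 : ℕ) : ℕ∞))
    (hpos : ∀ s, 6 ≤ s → s ≤ 16 → 0 < (cntSeries 5 s (Cs.map Finset.card) : ℚ))
    (hsum : 1 ≤ countSum 16 5 3 (cPrimeDGP 5 3 5 1 2) (29 / 216 : ℚ) (fun s => (cntSeries 5 s (Cs.map Finset.card) : ℚ))) :
    LocalShadowHall M 5 G := by
  have hk' : kColoops M G + 5 = 5 + 1 := by omega
  have hd' : (gr M \ G).card ≤ 5 := by omega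
  have hm2 : ∀ B ∈ thinMembers M 5 G, 5 ≤ (B \ coloops M G).card → 2 ≤ (G \ clF M B).card :=
    fun B hB _ => two_le_card_sdiff_of_not_lay0 hG hd' (mem_thinMembers.1 hB).1 (mem_thinMembers.1 hB).2
  have hc2 : 0 ≤ cPrimeDGP 5 3 5 (kColoops M G) 2 := by
    rw [hk]; unfold cPrimeDGP capDG reqDGP phiQ; norm_num
  have hn' : G.card - kColoops M G = 16 := by omega
  have hKG : coloops M G ⊆ G := fun y hy => (mem_coloops.1 hy).1
  have hnK : (G \ coloops M G).card = 16 := by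
    rw [Finset.card_sdiff_of_subset hKG, ← kColoops_eq_card_coloops]; omega
  refine localShadowHall_excess_of_count (d := 3) (ρ := 5) (m₁ := 2) hG hd (by norm_num) hk' (by norm_num)
    hs hl hc2 hm2 (E := (29 / 216 : ℚ)) (by norm_num) ?_ (cnt := fun s => (cntSeries 5 s (Cs.map Finset.card) : ℚ)) ?_ ?_ ?_
  · intro S _ T hT
    have hT' : T ∈ (S \ coloops M G).powersetCard 5 := by
      unfold coverBases at hT
      exact (Finset.mem_filter.1 hT).1
    have h := sum_faceLoss_budgetFSK_union_le (k := 1) (a := (1 / 5 : ℚ)) (b := (1 / 90 : ℚ)) hG hd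
      (by norm_num) hk' (by norm_num) hs hl (by norm_num) (by rw [hnK]; norm_num)
      (by rw [hnK]; intro m h1 h2; exact chord3_three_one_16 m h1 (by omega)) (by norm_num)
      (by rw [hnK, hk, fatBudgetFSK_three_one_sixteen_one]; norm_num) hcl hT'
    rw [hnK, hk, fatBudgetFSK_three_one_sixteen_one] at h
    exact h
  · intro s h1 h2
    rw [hn'] at h2
    exact hpos s h1 h2
  · intro S hSG
    exact card_coverBases_le_cntSeries hk' Cs hpw hsz hcoc hSG
  · rw [hn', hk]
    exact hsum

end PercRepro.Shadow
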